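import Summits.Ventures.Crystal3D.Bulk.HullFaceSubtendedEar
import HarnessLib

/-!
# A point in the corner fan of a face lies in the CLOSED CONE of the face (ear induction; input
# of the (d3) census assembly of HEX-PERIMETER, `DESIGN-L12-THEORY` §P-L3 (d))

HONEST FRAMING. Part of the venture `Summits/Ventures/Crystal3D` (cell `pub-crystal3d`, phase 2;
seat typer-bulk-2), generic and configuration-free (`X` any finite set of unit vectors of `ℝ³`
with `0` interior to its hull); nothing here mentions GAP(1.26). p3's `InCornerFan S d z`
(`Bulk/HullFaceSubtended.lean`) says "`z` lies in the closed face of `d`" through the fan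
triangles swept by the corners; the metric theorem of (d3) wants the facet form
`∀ t, 0 ≤ orient3 v_{t+1} v_t z` (`v = faceVertex S d`; walk orientation, clockwise seen from
outside; no new definition is introduced).

* **`HullRotSys.inFaceCone_of_cover`** — for an `α`-closed, covering, connected sub-map `S` of
  the hull fan with all corners `< π`, `d ∈ S` and ANY `z` with `InCornerFan S d z`:
  `∀ t, 0 ≤ orient3 v_{t+1} v_t z`.

Proof = the induction of `Bulk/HullFaceSubtendedInduction.lean` (p3) with this invariant: whole
fan ⇒ `exists_combination_of_inCornerFan_univ`; otherwise insert the diagonal of an ear; faces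
off the ear keep walk and corner fan; on the face of the ear (`inCornerFan_ear_cases`) either `z`
is a nonnegative combination of three vertices of the CONVEX face (LEMMA L,
`faceConvex_of_cover`), or it is in the cone of the shortened face `F'` by induction: the sides
of `F` other than the two ear sides are sides of `F'`, and for the ear side `v₀v₁` (resp. `v₁v₂`)
Cramer's expansion of `z` in the basis `v₀, v_{m−1}, v₂` (resp. `v₂, v₀, v₃`, `orient3_expand`)
has nonnegative coefficients off `v₀` (resp. `v₂`) by two `F'`-rows, and the `F`-row of the ear
side is `≥ 0` at every vertex of `F`.
-/

noncomputable section

namespace Summit.Ventures.Crystal3D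

namespace HullRotSys

open Literature.Geometry.DiscreteGeometry Finset Equiv Real Function
open scoped InnerProductSpace

variable {X : Finset (EuclideanSpace ℝ (Fin 3))} {hX1 : ∀ y ∈ X, ‖y‖ = 1}
  {h0 : (0 : EuclideanSpace ℝ (Fin 3)) ∈ interior (convexHull ℝ (X : Set _))}

/-! ## The closed cone of a face walk -/

/-- "`z` LIES IN THE CLOSED CONE OF THE FACE OF `d`" is the statement
`∀ t, 0 ≤ orient3 (faceVertex S d (t + 1)) (faceVertex S d t) z` (facet form, walk orientation:
`z` is on the inner side of the plane of every side `v_t v_{t+1}` of the walk). It is a property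
of the face (backward shift along the walk). -/
theorem inFaceCone_shift {S : Finset ↥(hullDarts X)} {d : ↥(hullDarts X)} {z : EuclideanSpace ℝ (Fin 3)}
    (h : ∀ t, 0 ≤ orient3 (faceVertex hX1 h0 S d (t + 1)) (faceVertex hX1 h0 S d t) z) (r t : ℕ) :
    0 ≤ orient3 (faceVertex hX1 h0 S (faceDart hX1 h0 S d r) (t + 1))
      (faceVertex hX1 h0 S (faceDart hX1 h0 S d r) t) z := by
  rw [faceVertex_shift, faceVertex_shift, show t + 1 + r = t + r + 1 by ring]
  exact h (t + r)

/-- It suffices to check the sides `t < period`. -/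
theorem inFaceCone_of_lt {S : Finset ↥(hullDarts X)} {d : ↥(hullDarts X)} {z : EuclideanSpace ℝ (Fin 3)}
    (h : ∀ t, t < facePeriod hX1 h0 S d →
      0 ≤ orient3 (faceVertex hX1 h0 S d (t + 1)) (faceVertex hX1 h0 S d t) z) (t : ℕ) :
    0 ≤ orient3 (faceVertex hX1 h0 S d (t + 1)) (faceVertex hX1 h0 S d t) z := by
  set m := facePeriod hX1 h0 S d with hm
  have hpos : 0 < m := facePeriod_pos S d
  have e1 : faceVertex hX1 h0 S d t = faceVertex hX1 h0 S d (t % m) := by rw [hm, faceVertex_mod]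
  have key : (t + 1) % m = (t % m + 1) % m := by rw [Nat.add_mod t 1 m, Nat.add_mod (t % m) 1 m, Nat.mod_mod]
  have e2 : faceVertex hX1 h0 S d (t + 1) = faceVertex hX1 h0 S d (t % m + 1) := by
    rw [← faceVertex_mod S d (t + 1), ← faceVertex_mod S d (t % m + 1), ← hm, key]
  rw [e1, e2]; exact h _ (Nat.mod_lt _ hpos)

/-- Untouched walk: same face cone. -/
theorem inFaceCone_of_forall_phi_eq {S S' : Finset ↥(hullDarts X)} {d : ↥(hullDarts X)}
    (heq : ∀ t, RotSys.phi (rot hX1 h0) (inv X) S' (faceDart hX1 h0 S d t) =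
      RotSys.phi (rot hX1 h0) (inv X) S (faceDart hX1 h0 S d t)) {z : EuclideanSpace ℝ (Fin 3)}
    (h : ∀ t, 0 ≤ orient3 (faceVertex hX1 h0 S' d (t + 1)) (faceVertex hX1 h0 S' d t) z) (t : ℕ) :
    0 ≤ orient3 (faceVertex hX1 h0 S d (t + 1)) (faceVertex hX1 h0 S d t) z := by
  rw [← faceVertex_eq_of_forall_phi_eq heq, ← faceVertex_eq_of_forall_phi_eq heq]
  exact h t

/-! ## A convex face: its side functionals are nonnegative at its vertices -/

/-- **For a convex face walk, every side functional is `≥ 0` at every vertex of the walk**: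
`0 ≤ det[v_{t+1}; v_t; v_j]` for all `t, j`. -/
theorem FaceConvex.orient3_side_vertex_nonneg {S : Finset ↥(hullDarts X)} {d : ↥(hullDarts X)}
    (hc : FaceConvex hX1 h0 S d) (t j : ℕ) :
    0 ≤ orient3 (faceVertex hX1 h0 S d (t + 1)) (faceVertex hX1 h0 S d t) (faceVertex hX1 h0 S d j) := by
  refine inFaceCone_of_lt (fun t htm => ?_) t
  rw [faceConvex_iff_orient3_neg] at hc
  set m := facePeriod hX1 h0 S d with hm
  set v := faceVertex hX1 h0 S d with hv
  have hvm : v m = v 0 := by simpa using faceVertex_add_period (hX1 := hX1) (h0 := h0) S d 0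
  have e3 : v j = v (j % m) := by rw [hv, hm, faceVertex_mod]
  rw [e3]
  set j' := j % m with hj'
  have hjm : j' < m := Nat.mod_lt _ (facePeriod_pos S d)
  -- cases on the position of `j'`
  rcases lt_trichotomy j' t with hlt | heq | hgt
  · rcases Nat.lt_or_ge (t + 1) m with h1 | h1
    · have := hc j' t (t + 1) hlt (Nat.lt_succ_self _) h1
      rw [orient3_swap_outer]; linarith
    · rw [show t + 1 = m by omega, hvm]
      rcases Nat.eq_zero_or_pos j' with hj0 | hj0
      · rw [hj0, orient3_self_outer]
      · have := hc 0 j' t hj0 hlt htm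
        rw [orient3_swap_right]; linarith
  · rw [heq, orient3_self_right]
  · rcases Nat.lt_or_ge (t + 1) j' with h1 | h1
    · have := hc t (t + 1) j' (Nat.lt_succ_self _) h1 hjm
      rw [orient3_swap_left]; linarith
    · rw [show j' = t + 1 by omega, orient3_self_outer]

/-- **A nonnegative combination of three vertices of a convex face lies in its cone.** -/
theorem FaceConvex.inFaceCone_of_combination {S : Finset ↥(hullDarts X)} {d : ↥(hullDarts X)}
    (hc : FaceConvex hX1 h0 S d) {z : EuclideanSpace ℝ (Fin 3)} {a b c : ℝ} (ha : 0 ≤ a)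
    (hb : 0 ≤ b) (hc' : 0 ≤ c) {i j k : ℕ}
    (hz : z = a • faceVertex hX1 h0 S d i + b • faceVertex hX1 h0 S d j + c • faceVertex hX1 h0 S d k)
    (t : ℕ) : 0 ≤ orient3 (faceVertex hX1 h0 S d (t + 1)) (faceVertex hX1 h0 S d t) z := by
  rw [hz, orient3_add_right, orient3_add_right, orient3_smul_right, orient3_smul_right,
    orient3_smul_right]
  have h1 := hc.orient3_side_vertex_nonneg t i
  have h2 := hc.orient3_side_vertex_nonneg t j
  have h3 := hc.orient3_side_vertex_nonneg t k
  positivity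

/-- **Cramer gluing.** If `0 < det[p;q;r]`, `z` is on the nonnegative side of the planes `p r`
(`0 ≤ det[p;z;r]`) and `p q` (`0 ≤ det[p;q;z]`), and a functional `det[a;b;·]` vanishes at `p`
and is `≥ 0` at `q` and `r`, then it is `≥ 0` at `z` (expand `z` in the basis `p, q, r`). -/
theorem orient3_nonneg_of_cramer {p q r z a b : EuclideanSpace ℝ (Fin 3)} (hD : 0 < orient3 p q r)
    (h1 : 0 ≤ orient3 p z r) (h2 : 0 ≤ orient3 p q z) (hp : orient3 a b p = 0)
    (hq : 0 ≤ orient3 a b q) (hr : 0 ≤ orient3 a b r) : 0 ≤ orient3 a b z := by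
  have key : orient3 p q r * orient3 a b z = orient3 p z r * orient3 a b q + orient3 p q z * orient3 a b r := by
    have := congrArg (orient3 a b) (orient3_expand p q r z)
    rw [orient3_smul_right, orient3_add_right, orient3_add_right, orient3_smul_right,
      orient3_smul_right, orient3_smul_right, hp, mul_zero, zero_add] at this
    exact this
  exact nonneg_of_mul_nonneg_right (by rw [key]; positivity) hD

/-! ## The whole fan -/

/-- The first three vertices of a face walk of the whole fan: `y, a, succV X a y` for `d = (y, a)`. -/
theorem faceVertex_univ_zero_one_two (d : ↥(hullDarts X)) :
    faceVertex hX1 h0 univ d 0 = d.1.1 ∧ faceVertex hX1 h0 univ d 1 = d.1.2 ∧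
      faceVertex hX1 h0 univ d 2 = succV X d.1.2 d.1.1 := by
  obtain ⟨⟨y, a⟩, hd⟩ := d
  unfold faceVertex faceDart
  refine ⟨?_, ?_, ?_⟩
  · rw [pow_zero, Perm.one_apply]
  · rw [phi_univ_pow_apply, iterate_one, hullFace_mk]
  · rw [phi_univ_pow_apply, show (2 : ℕ) = 1 + 1 from rfl, iterate_succ, iterate_one, comp_apply,
      hullFace_mk, hullFace_mk]

/-! ## The induction -/

/-- **The induction** (on the number of hull darts outside `S`). -/
theorem inFaceCone_aux :
    ∀ (N : ℕ) (S : Finset ↥(hullDarts X)), (univ \ S).card = N → RotSys.IsClosed (inv X) S →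
      (∀ y ∈ X, ∃ z ∈ S, z.1.1 = y) → RotSys.numK (rot hX1 h0) (inv X) S = 1 →
      (∀ z ∈ S, RotSys.cornerAt (rot hX1 h0) (dartWeight X) S z < π) →
      ∀ d ∈ S, ∀ z : EuclideanSpace ℝ (Fin 3), InCornerFan hX1 h0 S d z →
        ∀ t, 0 ≤ orient3 (faceVertex hX1 h0 S d (t + 1)) (faceVertex hX1 h0 S d t) z := by
  intro N
  induction N using Nat.strong_induction_on with
  | _ N ih =>
  intro S hN hS hcov hk hlt d hd z hfan
  have hrs : RotSys.IsRotSys (rot hX1 h0) (inv X) := isRotSys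
  -- the whole fan: base case
  by_cases huniv : S = univ
  · subst huniv
    obtain ⟨a, b, c, ha, hb, hc, hz⟩ := exists_combination_of_inCornerFan_univ hfan
    obtain ⟨e0, e1, e2⟩ := faceVertex_univ_zero_one_two (hX1 := hX1) (h0 := h0) d
    exact (faceConvex_of_cover hS hcov hk hlt hd).inFaceCone_of_combination ha hb hc (i := 0) (j := 1)
      (k := 2) (by rw [e0, e1, e2]; exact hz)
  -- otherwise a long face, hence an ear `e`
  obtain ⟨d₀, hd₀, h4⟩ := exists_long_face_of_ne_univ hS hcov hk hlt huniv
  obtain ⟨e, he, hm4, hear⟩ := exists_ear_of_cover hS hcov hk ⟨d₀, hd₀, h4⟩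
  set φ := RotSys.phi (rot hX1 h0) (inv X) S with hφ
  set m := facePeriod hX1 h0 S e with hmdef
  have hme : minimalPeriod φ e = m := rfl
  set f1 := φ e with hf1
  set g := rot hX1 h0 (inv X f1) with hgdef
  have htri : rot hX1 h0 (inv X g) = e := by rw [hgdef, hear]; exact rot_inv_rot_inv_rot_inv e
  -- `g ∉ S`, else the face of `e` would be the triangle
  have hgS : g ∉ S := by
    intro hgS
    have hf1S : f1 ∈ S := RotSys.phi_apply_mem hS he
    have h1 : φ f1 = g := by
      rw [hφ, RotSys.phi_apply]
      exact RotSys.induce_eq_of_first_return _ (hS _ hf1S) Nat.one_pos (by rw [pow_one])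
        hgS (fun m hm0 hm1 => absurd hm1 (by omega))
    have h2 : φ g = e := by
      rw [hφ, RotSys.phi_apply]
      exact RotSys.induce_eq_of_first_return _ (hS _ hgS) Nat.one_pos (by rw [pow_one]; exact htri)
        he (fun m hm0 hm1 => absurd hm1 (by omega))
    have h3 : (φ ^ 3) e = e := by
      rw [pow_succ, pow_two, Perm.mul_apply, Perm.mul_apply, ← hf1, h1, h2]
    have hper : IsPeriodicPt φ 3 e := by
      rw [IsPeriodicPt, IsFixedPt, ← RotSys.pow_apply_eq_iterate]; exact h3
    have := hper.minimalPeriod_le (by norm_num)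
    rw [hme] at this
    omega
  -- the enlarged map
  set S' := S ∪ {g, inv X g} with hS'def
  have hsub : S ⊆ S' := subset_union_left
  have hS'c : RotSys.IsClosed (inv X) S' := RotSys.isClosed_union_ear hrs hS
  have hαgS : inv X g ∉ S := RotSys.alpha_g_not_mem hrs hS hgS
  have hgS' : g ∈ S' := mem_union_right _ (mem_insert_self _ _)
  have hαgS' : inv X g ∈ S' := mem_union_right _ (mem_insert_of_mem (mem_singleton_self _))
  have hN' : (univ \ S').card < N := by
    have hlt' : (univ \ S').card < (univ \ S).card := by
      apply Finset.card_lt_card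
      refine ⟨sdiff_subset_sdiff Subset.rfl hsub, fun hle => ?_⟩
      have : g ∈ univ \ S := mem_sdiff.2 ⟨mem_univ _, hgS⟩
      have := hle this
      rw [mem_sdiff] at this
      exact this.2 hgS'
    rw [hN] at hlt'; exact hlt'
  have hcov' : ∀ y ∈ X, ∃ z ∈ S', z.1.1 = y := fun y hy => by
    obtain ⟨w, hw, hwy⟩ := hcov y hy; exact ⟨w, hsub hw, hwy⟩
  have hk' : RotSys.numK (rot hX1 h0) (inv X) S' = 1 := numK_eq_one_of_cover hsub hcov hk
  -- the splice facts
  set φ' := RotSys.phi (rot hX1 h0) (inv X) S' with hφ'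
  have hφ'f1 : φ' f1 = g := RotSys.phi_union_ear_f1 hS he
  have hφ'αg : φ' (inv X g) = (φ ^ 2) e := RotSys.phi_union_ear_alpha_g hrs hS he hgS
  have hφ'g : φ' g = e := RotSys.phi_union_ear_g he htri
  have hφ'last : φ' ((φ ^ (m - 1)) e) = inv X g :=
    RotSys.phi_union_ear_last hrs hS he htri hgS (by rw [hme]; omega)
  -- all corners of `S'` are `< π`
  have hlt' : ∀ z ∈ S', RotSys.cornerAt (rot hX1 h0) (dartWeight X) S' z < π := by
    intro x hx
    rw [hS'def, mem_union, mem_insert, mem_singleton] at hx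
    rcases hx with hx | rfl | rfl
    · exact (cornerAt_mono hsub hx).trans_lt (hlt x hx)
    · have hx : inv X f1 ∈ S := hS _ (RotSys.phi_apply_mem hS he)
      have hind : RotSys.induce (rot hX1 h0) S' (inv X f1) = g := RotSys.induce_eq_of_first_return _
        (hsub hx) Nat.one_pos (by rw [pow_one]) hgS' (fun m hm0 hm1 => absurd hm1 (by omega))
      have hind2 : RotSys.induce (rot hX1 h0) S' g ∈ S := by
        have : RotSys.induce (rot hX1 h0) S' g = φ' (inv X g) := by
          rw [hφ', RotSys.phi_apply, hrs.α_inv]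
        rw [this, hφ'αg]
        exact RotSys.phi_pow_apply_mem hS he 2
      have hsplit := RotSys.cornerAt_subset_of_not_mem (rot hX1 h0) (dartWeight X) hsub hx
        (by rw [hind]; exact hgS) (by rw [hind]; exact hind2)
      rw [hind] at hsplit
      have := hlt _ hx
      have h0' := cornerAt_nonneg (hX1 := hX1) (h0 := h0) S' (inv X f1)
      linarith
    · have hx : inv X ((φ ^ (m - 1)) e) ∈ S := hS _ (RotSys.phi_pow_apply_mem hS he (m - 1))
      have hind : RotSys.induce (rot hX1 h0) S' (inv X ((φ ^ (m - 1)) e)) = inv X g := by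
        rw [← RotSys.phi_apply]; exact hφ'last
      have hind2 : RotSys.induce (rot hX1 h0) S' (inv X g) ∈ S := by
        have : RotSys.induce (rot hX1 h0) S' (inv X g) = φ' g := by rw [hφ', RotSys.phi_apply]
        rw [this, hφ'g]; exact he
      have hsplit := RotSys.cornerAt_subset_of_not_mem (rot hX1 h0) (dartWeight X) hsub hx
        (by rw [hind]; exact hαgS) (by rw [hind]; exact hind2)
      rw [hind] at hsplit
      have := hlt _ hx
      have h0' := cornerAt_nonneg (hX1 := hX1) (h0 := h0) S' (inv X ((φ ^ (m - 1)) e))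
      linarith
  -- the induction hypothesis on `S'`
  have hIH : ∀ x ∈ S', ∀ w : EuclideanSpace ℝ (Fin 3), InCornerFan hX1 h0 S' x w →
      ∀ t, 0 ≤ orient3 (faceVertex hX1 h0 S' x (t + 1)) (faceVertex hX1 h0 S' x t) w :=
    ih _ hN' S' rfl hS'c hcov' hk' hlt'
  -- CASE B: `d` is not on the face of the ear — walk and corner fan are untouched
  by_cases hsame : ¬ φ.SameCycle e d
  · have heq : ∀ t, φ' (faceDart hX1 h0 S d t) = φ (faceDart hX1 h0 S d t) := by
      intro t
      set x := faceDart hX1 h0 S d t with hxdef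
      have hxS : x ∈ S := faceDart_mem hS hd t
      have hxd : φ.SameCycle d x := ⟨(t : ℤ), by rw [zpow_natCast]; rfl⟩
      have key := RotSys.phi_eq_splice hrs hS hgS hxS
      rw [← hgdef, ← hS'def, ← hφ, ← hφ'] at key
      have hne1 : φ' x ≠ g := by
        intro heq
        rw [← hφ'f1] at heq
        have hxf1 : x = f1 := φ'.injective heq
        apply hsame
        have h1 : φ.SameCycle e f1 := ⟨1, by rw [zpow_one]⟩
        exact h1.trans (hxf1 ▸ hxd.symm)
      have hne2 : φ' x ≠ inv X g := by
        intro heq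
        rw [if_neg hne1, if_pos heq, hφ'g] at key
        apply hsame
        have h1 : φ.SameCycle x e := ⟨1, by rw [zpow_one, key]⟩
        exact (hxd.trans h1).symm
      rw [if_neg hne1, if_neg hne2] at key; exact key.symm
    have hfan' : InCornerFan hX1 h0 S' d z := inCornerFan_of_forall_phi_eq hsub hS hd heq hfan
    exact inFaceCone_of_forall_phi_eq heq (hIH d (hsub hd) z hfan')
  -- CASE A: `d` is on the face of the ear; work with the walk of `e` and shift at the end
  rw [not_not] at hsame
  obtain ⟨r, -, hr⟩ := RotSys.SameCycle.exists_lt_minimalPeriod hsame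
  have hdr : d = faceDart hX1 h0 S e r := by unfold faceDart; rw [← hφ, hr]
  have hfan_e : InCornerFan hX1 h0 S e z := InCornerFan.of_shift r (hdr ▸ hfan)
  have hconv_e : FaceConvex hX1 h0 S e := faceConvex_of_cover hS hcov hk hlt he
  -- it suffices to treat `e`
  suffices hmain : ∀ t, 0 ≤ orient3 (faceVertex hX1 h0 S e (t + 1)) (faceVertex hX1 h0 S e t) z by
    rw [hdr]; exact inFaceCone_shift hmain r
  -- the two walks
  set v := faceVertex hX1 h0 S e with hvdef
  set u := faceVertex hX1 h0 S' (inv X g) with hudef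
  have hper' : facePeriod hX1 h0 S' (inv X g) = m - 1 :=
    RotSys.minimalPeriod_phi_union_ear hrs hS he htri hgS (by rw [hme]; omega)
  have hvm : v m = v 0 := by simpa only [zero_add] using faceVertex_add_period (hX1 := hX1) (h0 := h0) S e 0
  have hu0 : u 0 = v 0 := by
    rw [hudef, hvdef]
    unfold faceVertex
    rw [faceDart_zero, faceDart_zero, inv_apply_val, Prod.fst_swap]
    have : (rot hX1 h0 (inv X g)).1.1 = (inv X g).1.1 := by
      have := rot_pow_apply_fst (hX1 := hX1) (h0 := h0) 1 (inv X g); rwa [pow_one] at this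
    rw [inv_apply_val, Prod.fst_swap] at this; rw [← this, htri]
  have huk : ∀ k, 1 ≤ k → k + 2 ≤ m → u k = v (k + 1) := by
    intro k hk1 hk
    rw [hudef, hvdef]
    unfold faceVertex faceDart
    rw [RotSys.pow_phi_union_ear_alpha_g hrs hS he htri hgS hk1 (by rw [hme]; omega)]
  have hum : u (m - 1) = v 0 := by
    have := faceVertex_add_period (hX1 := hX1) (h0 := h0) S' (inv X g) 0
    rw [hper', zero_add] at this
    change faceVertex hX1 h0 S' (inv X g) (m - 1) = v 0
    rw [this]; exact hu0
  -- where is `z`?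
  have hcases : (∃ a b c : ℝ, 0 ≤ a ∧ 0 ≤ b ∧ 0 ≤ c ∧ z = a • v 0 + b • v 1 + c • v 2) ∨
      InCornerFan hX1 h0 S' (inv X g) z :=
    inCornerFan_ear_cases hS he hear hm4 hgS hfan_e
  rcases hcases with ⟨a, b, c, ha, hb, hc, hzT⟩ | hfan'
  · -- `z` in the ear triangle: three vertices of the convex face of `e`
    exact hconv_e.inFaceCone_of_combination ha hb hc hzT
  · -- `z` in the corner fan of the shortened face: induction hypothesis, glued back
    have hrow' : ∀ k, 0 ≤ orient3 (u (k + 1)) (u k) z := hIH (inv X g) hαgS' z hfan'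
    have hconv' : FaceConvex hX1 h0 S' (inv X g) := faceConvex_of_cover hS'c hcov' hk' hlt' hαgS'
    rw [faceConvex_iff_orient3_neg, hper'] at hconv'
    have hcu : ∀ i j k : ℕ, i < j → j < k → k < m - 1 → orient3 (u i) (u j) (u k) < 0 := hconv'
    -- the side functionals of `F` at its vertices
    have hF : ∀ t j, 0 ≤ orient3 (v (t + 1)) (v t) (v j) := hconv_e.orient3_side_vertex_nonneg
    refine inFaceCone_of_lt fun t (htm : t < m) => ?_
    change 0 ≤ orient3 (v (t + 1)) (v t) z
    by_cases ht0 : t = 0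
    · -- the ear side `v₀ v₁`: Cramer in the basis `v₀, v_{m-1}, v₂`
      subst ht0
      rw [zero_add]
      have hD : 0 < orient3 (v 0) (v (m - 1)) (v 2) := by
        have := hcu 0 1 (m - 2) Nat.zero_lt_one (by omega) (by omega)
        rw [hu0, huk 1 le_rfl (by omega), huk (m - 2) (by omega) (by omega),
          show m - 2 + 1 = m - 1 by omega] at this
        rw [orient3_swap_right]; linarith
      have hr1 : 0 ≤ orient3 (v 2) (v 0) z := by
        have := hrow' 0; rwa [zero_add, huk 1 le_rfl (by omega), hu0] at this
      have hr2 : 0 ≤ orient3 (v 0) (v (m - 1)) z := by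
        have := hrow' (m - 2)
        rwa [show m - 2 + 1 = m - 1 by omega, hum, huk (m - 2) (by omega) (by omega),
          show m - 2 + 1 = m - 1 by omega] at this
      refine orient3_nonneg_of_cramer hD (by rw [orient3_cyclic, orient3_cyclic]; exact hr1) hr2
        (orient3_self_right _ _) ?_ ?_
      · simpa using hF 0 (m - 1)
      · simpa using hF 0 2
    by_cases ht1 : t = 1
    · -- the ear side `v₁ v₂`: Cramer in the basis `v₂, v₀, v₃`
      subst ht1
      rw [show (1 : ℕ) + 1 = 2 from rfl]
      have hv3 : u 2 = v 3 := huk 2 (by omega) (by omega)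
      have hD : 0 < orient3 (v 2) (v 0) (v 3) := by
        have := hcu 0 1 2 Nat.zero_lt_one (by omega) (by omega)
        rw [hu0, huk 1 le_rfl (by omega), hv3] at this
        rw [orient3_swap_left]; linarith
      have hr1 : 0 ≤ orient3 (v 2) (v 0) z := by
        have := hrow' 0; rwa [zero_add, huk 1 le_rfl (by omega), hu0] at this
      have hr2 : 0 ≤ orient3 (v 3) (v 2) z := by
        have := hrow' 1; rwa [show (1 : ℕ) + 1 = 2 from rfl, hv3, huk 1 le_rfl (by omega)] at this
      refine orient3_nonneg_of_cramer hD (by rw [orient3_cyclic, orient3_cyclic]; exact hr2) hr1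
        (orient3_self_outer _ _) ?_ ?_
      · simpa using hF 1 0
      · simpa using hF 1 3
    · -- the other sides of `F` are sides of `F'`
      have ht2 : 2 ≤ t := by omega
      have h := hrow' (t - 1)
      rw [show t - 1 + 1 = t by omega, huk (t - 1) (by omega) (by omega),
        show t - 1 + 1 = t by omega] at h
      have hut : u t = v (t + 1) := by
        rcases Nat.lt_or_ge t (m - 1) with hlt'' | hge
        · exact huk t (by omega) (by omega)
        · rw [show t = m - 1 by omega, hum, show m - 1 + 1 = m by omega, hvm]
      rw [hut] at h; exact h

/-- **A point in the corner fan of a face lies in the closed cone of the face.** For an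
`α`-closed, covering, connected sub-map `S` of the hull fan with all corners `< π`, a dart
`d ∈ S` and any vector `z` in the corner fan of the face of `d`: `0 ≤ det[v_{t+1}; v_t; z]` for
every side `v_t v_{t+1}` of the face walk. -/
theorem inFaceCone_of_cover {S : Finset ↥(hullDarts X)} (hS : RotSys.IsClosed (inv X) S)
    (hcov : ∀ y ∈ X, ∃ z ∈ S, z.1.1 = y) (hk : RotSys.numK (rot hX1 h0) (inv X) S = 1)
    (hlt : ∀ z ∈ S, RotSys.cornerAt (rot hX1 h0) (dartWeight X) S z < π)
    {d : ↥(hullDarts X)} (hd : d ∈ S) {z : EuclideanSpace ℝ (Fin 3)}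
    (hfan : InCornerFan hX1 h0 S d z) (t : ℕ) :
    0 ≤ orient3 (faceVertex hX1 h0 S d (t + 1)) (faceVertex hX1 h0 S d t) z :=
  inFaceCone_aux _ S rfl hS hcov hk hlt d hd z hfan t

end HullRotSys

end Summit.Ventures.Crystal3D

end
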